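import Literature.Geometry.Lorentzian.InteriorKerrGluingProofs
import Literature.Geometry.Lorentzian.UnitNormalUniqueness
import Mathlib.Analysis.Calculus.ContDiff.Operations
import Mathlib.Analysis.SpecialFunctions.Sqrt
import Mathlib.LinearAlgebra.Dual.Lemmas
import HarnessLib

/-!
# The unit normal of the Schwarzschild cylinder map for an arbitrary metric

Support file (all results proved; definitions with bodies, theorems; no named facts) for the
transport of J. Li, H. Mei, *A construction of collapsing spacetimes in vacuum*, Comm. Math. Phys.
378 (2020) = arXiv:2005.01249, §2.2 ("the initial data induced on `H` by `g`", `H` the EXACT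
`g_{m₀}`-cylinder `{r = r₀}` and `g` a vacuum metric merely CLOSE to `g_{m₀}`) to the tree's
`LiMei.NearSchwarzschildCylinder`: to estimate the second fundamental form of the fixed cylinder map
`ψ = schwCylMap r₀ 0` with respect to a general metric coefficient field `G` one needs its unit normal
as an EXPLICIT smooth function of `(y, G(ψ y))`.

* The conormal of the cylinder is metric-independent: `cylConormal y = ⟪y, x⃗(·)⟫` annihilates
  `dψ_y` (`cylConormal_schwCylDeriv`).
* `rawNormal y β = β⁻¹(cylConormal y)` (Mathlib's `ContinuousLinearMap.inverse` of
  `β : E4 →L (E4 →L ℝ)`), `normSq (y, β) = β(n, n) = cylConormal y (n)`, and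
  `unitNormalOf (y, β) = (−normSq)^{-1/2} n`, smooth on the open set `normalDomain = {normSq < 0}`
  (`isOpen_normalDomain`, `contDiffOn_unitNormalOf`: inversion is smooth, `contDiffAt_map_inverse`).
* On `normalDomain`, for symmetric `β`: `unitNormalOf` is `β`-normal to `dψ_y`, has `β`-square `−1`,
  and points to DECREASING area radius, `⟪y, x⃗(unitNormalOf)⟫ < 0` — for every `β`
  (`inner_spatial_unitNormalOf_neg`: `⟪y, x⃗(n)⟫ = β(n, n) < 0`).
* **Identification** (`eq_unitNormalOf`, pointwise): for a Lorentzian metric `g` on a chart domain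
  of `E4` and a point `x` at which the model differential `dψ_y` is spacelike, every `g_x`-unit
  normal `n` of sign `−1` to `dψ_y(E3)` with `⟪y, x⃗(n)⟫ < 0` IS `unitNormalOf (y, g_x)`, and
  `(y, g_x) ∈ normalDomain` (the normal line of a spacelike hyperplane is spanned by any unit normal,
  `smul_of_normal_of_unit`, O'Neill 1983, Ch. 5, Lemma 5.26). In particular the tree's model normal
  `schwCylNormalRep M r₀ y` is `unitNormalOf (y, g_M(ψ y))` for every `y ≠ 0`
  (`schwCylNormalRep_eq_unitNormalOf`).

## References

* J. Li, H. Mei, arXiv:2005.01249, §2.2 and (4.1) (key `LiMei2020`).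
* B. O'Neill, *Semi-Riemannian geometry* (1983), Ch. 4, pp. 106–107; Ch. 5, Lemma 5.26
  (key `ONeill1983`).
-/

noncomputable section

open Bundle Set Function Filter Manifold TopologicalSpace Module
open scoped Manifold ContDiff Topology RealInnerProductSpace

namespace Literature.Geometry.Lorentzian

/-! ### The normal line of a spacelike hyperplane is spanned by any unit normal -/

namespace LorentzianMetric

variable {E : Type*} [NormedAddCommGroup E] [NormedSpace ℝ E] {H : Type*} [TopologicalSpace H]
  {I : ModelWithCorners ℝ E H} {M : Type*} [TopologicalSpace M] [ChartedSpace H M]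
  {E' : Type*} [NormedAddCommGroup E'] [NormedSpace ℝ E'] [IsManifold I ∞ M] {n : ℕ∞ω}
  [FiniteDimensional ℝ E] [FiniteDimensional ℝ E'] (g : LorentzianMetric I n M) {x : M}

/-- **Any normal to a spacelike hyperplane is a multiple of a unit normal (pointwise).** Let
`L : E' →L E = T_x M` be linear with `g_x(L v, L v) > 0` for `v ≠ 0` and `dim E = dim E' + 1`; if
`n₁` is `g_x`-orthogonal to `range L` with `g_x(n₁, n₁) = −1` and `n₂` is `g_x`-orthogonal to
`range L`, then `n₂ = c n₁` for some `c` (`range L ⊕ ℝ n₁ = T_x M` by a dimension count; the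
`range L`-component of `n₂` is `g`-orthogonal to the positive definite `range L`). O'Neill 1983,
Ch. 5, Lemma 5.26; Ch. 4, pp. 106–107. [cite: ONeill1983, Ch. 5, Lemma 5.26] -/
theorem smul_of_normal_of_unit (hdim : finrank ℝ E = finrank ℝ E' + 1)
    (L : E' →L[ℝ] TangentSpace I x) (hpos : ∀ v : E', v ≠ 0 → 0 < g.val x (L v) (L v))
    {n₁ n₂ : TangentSpace I x} (h₁ : ∀ v : E', g.val x n₁ (L v) = 0)
    (h₂ : ∀ v : E', g.val x n₂ (L v) = 0) (hu₁ : g.val x n₁ n₁ = -1) : ∃ c : ℝ, n₂ = c • n₁ := by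
  haveI : FiniteDimensional ℝ (TangentSpace I x) := inferInstanceAs (FiniteDimensional ℝ E)
  have hinj : Function.Injective (L : E' →ₗ[ℝ] TangentSpace I x) := by
    refine (injective_iff_map_eq_zero _).2 fun v hv ↦ ?_
    by_contra hne
    have := hpos v hne
    rw [ContinuousLinearMap.coe_coe] at hv
    rw [hv] at this
    simp at this
  have hn₁ : n₁ ∉ LinearMap.range (L : E' →ₗ[ℝ] TangentSpace I x) := by
    rintro ⟨v, hv⟩
    rw [ContinuousLinearMap.coe_coe] at hv
    by_cases hv0 : v = 0
    · subst hv0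
      rw [map_zero] at hv
      rw [← hv] at hu₁
      simp at hu₁
    · have := hpos v hv0
      rw [hv] at this
      linarith
  have hn₁0 : n₁ ≠ 0 := by
    rintro rfl
    simp at hu₁
  set W : Submodule ℝ (TangentSpace I x) := LinearMap.range (L : E' →ₗ[ℝ] TangentSpace I x) with hW
  set S : Submodule ℝ (TangentSpace I x) := ℝ ∙ n₁ with hS
  have hWdim : finrank ℝ W = finrank ℝ E' := LinearMap.finrank_range_of_inj hinj
  have hSdim : finrank ℝ S = 1 := finrank_span_singleton hn₁0
  have hdisj : W ⊓ S = ⊥ := by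
    rw [← disjoint_iff, Submodule.disjoint_span_singleton' hn₁0]
    exact hn₁
  have htop : W ⊔ S = ⊤ := by
    apply Submodule.eq_top_of_finrank_eq
    have h := Submodule.finrank_sup_add_finrank_inf_eq W S
    rw [hdisj, finrank_bot, add_zero, hWdim, hSdim] at h
    have hE : finrank ℝ (TangentSpace I x) = finrank ℝ E := rfl
    rw [h, hE, hdim]
  have hmem : n₂ ∈ W ⊔ S := by rw [htop]; exact Submodule.mem_top
  obtain ⟨w, hw, s, hs, hws⟩ := Submodule.mem_sup.1 hmem
  obtain ⟨v₀, rfl⟩ := LinearMap.mem_range.1 hw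
  obtain ⟨c, rfl⟩ := Submodule.mem_span_singleton.1 hs
  rw [ContinuousLinearMap.coe_coe] at hws
  have hv₀ : v₀ = 0 := by
    by_contra hv₀
    have hp := hpos v₀ hv₀
    have hz : g.val x (L v₀) (L v₀) = 0 := by
      have e := h₂ v₀
      rw [← hws] at e
      simp only [map_add, map_smul, add_apply, smul_apply,
        smul_eq_mul, h₁ v₀, mul_zero, add_zero] at e
      rw [g.symm x] at e
      exact e
    linarith
  subst hv₀
  rw [map_zero, zero_add] at hws
  exact ⟨c, hws.symm⟩

/-- **A nonzero normal to a spacelike hyperplane is timelike**: in the situation of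
`smul_of_normal_of_unit`, if `n₂ ≠ 0` then `g_x(n₂, n₂) < 0`. O'Neill 1983, Ch. 5, Lemma 5.26.
[cite: ONeill1983, Ch. 5, Lemma 5.26] -/
theorem val_self_neg_of_normal_of_unit (hdim : finrank ℝ E = finrank ℝ E' + 1)
    (L : E' →L[ℝ] TangentSpace I x) (hpos : ∀ v : E', v ≠ 0 → 0 < g.val x (L v) (L v))
    {n₁ n₂ : TangentSpace I x} (h₁ : ∀ v : E', g.val x n₁ (L v) = 0)
    (h₂ : ∀ v : E', g.val x n₂ (L v) = 0) (hu₁ : g.val x n₁ n₁ = -1) (hn₂ : n₂ ≠ 0) :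
    g.val x n₂ n₂ < 0 := by
  obtain ⟨c, rfl⟩ := g.smul_of_normal_of_unit hdim L hpos h₁ h₂ hu₁
  have hc : c ≠ 0 := by
    rintro rfl
    exact hn₂ (zero_smul _ _)
  simp only [map_smul, smul_apply, smul_eq_mul, hu₁]
  nlinarith [sq_pos_of_ne_zero hc]

end LorentzianMetric

namespace LiMei

/-! ### The conormal of the cylinder -/

/-- The CONORMAL of the cylinder `{‖x⃗‖ = r₀}` at `ψ(y)`, normalised by `‖y‖`: the covector
`X ↦ ⟪y, x⃗(X)⟫` on `E4` (`= ‖y‖ dr(X)` at `x⃗ = r₀ y/‖y‖`). It depends on `y` only — not on any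
metric. [folklore] -/
def cylConormal (y : E3) : E4 →L[ℝ] ℝ :=
  (innerSL ℝ (E := E3) y : E3 →L[ℝ] ℝ).comp E4.spatial

/-- `cylConormal y X = ⟪y, x⃗(X)⟫`. [folklore] -/
@[simp]
theorem cylConormal_apply (y : E3) (X : E4) : cylConormal y X = ⟪y, E4.spatial X⟫ := rfl

/-- **The conormal annihilates the tangent space of the cylinder**: `⟪y, x⃗(dψ_y v)⟫ = 0`
(`x⃗(dψ_y v) = (r₀/‖y‖) v − (r₀⟪y, v⟫/‖y‖³) y` is `⊥ y`). [folklore] -/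
theorem cylConormal_schwCylDeriv (r₀ : ℝ) {y : E3} (hy : y ≠ 0) (v : E3) :
    cylConormal y (schwCylDeriv r₀ y v) = 0 := by
  have hn : ‖y‖ ≠ 0 := norm_ne_zero_iff.2 hy
  rw [cylConormal_apply, spatial_schwCylDeriv, inner_add_right, inner_smul_right, inner_smul_right,
    real_inner_self_eq_norm_sq]
  field_simp
  ring

/-- The conormal is a nonzero covector for `y ≠ 0`: `cylConormal y (0, y) = ‖y‖²`. [folklore] -/
theorem cylConormal_spaceEmbed_self (y : E3) : cylConormal y (E4.spaceEmbed y) = ‖y‖ ^ 2 := by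
  rw [cylConormal_apply, E4.spaceEmbed_apply, E4.spatial_ofTimeSpace, real_inner_self_eq_norm_sq]

/-- `y ↦ cylConormal y` is a continuous linear map, hence smooth. [folklore] -/
theorem contDiff_cylConormal {n : ℕ∞ω} : ContDiff ℝ n (fun y : E3 ↦ cylConormal y) :=
  (((ContinuousLinearMap.compL ℝ E4 E3 ℝ).flip E4.spatial).comp
    (innerSL ℝ (E := E3) : E3 →L[ℝ] E3 →L[ℝ] ℝ)).contDiff

/-! ### The raw normal, its square, the unit normal -/

/-- The RAW NORMAL `β⁻¹(cylConormal y)`: the vector `n` with `β(n, ·) = ⟪y, x⃗(·)⟫` when the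
bilinear form `β` on `E4` is nondegenerate (Mathlib's `ContinuousLinearMap.inverse`; junk `0`
otherwise). [folklore] -/
def rawNormal (y : E3) (β : E4 →L[ℝ] E4 →L[ℝ] ℝ) : E4 :=
  ContinuousLinearMap.inverse β (cylConormal y)

/-- The `β`-SQUARE of the raw normal, `β(n, n)`. [folklore] -/
def normSq (p : E3 × (E4 →L[ℝ] E4 →L[ℝ] ℝ)) : ℝ :=
  p.2 (rawNormal p.1 p.2) (rawNormal p.1 p.2)

/-- The UNIT NORMAL `(−β(n, n))^{-1/2} n` of the cylinder map at `y` for the bilinear form `β`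
(meaningful on `normalDomain`). [folklore] -/
def unitNormalOf (p : E3 × (E4 →L[ℝ] E4 →L[ℝ] ℝ)) : E4 :=
  (Real.sqrt (-normSq p))⁻¹ • rawNormal p.1 p.2

/-- The domain where the raw normal is timelike: `{(y, β) | β(n, n) < 0}` (on it `β` is
automatically invertible, the junk value of the inverse giving `n = 0`). [folklore] -/
def normalDomain : Set (E3 × (E4 →L[ℝ] E4 →L[ℝ] ℝ)) :=
  {p | normSq p < 0}

/-- Membership in `normalDomain`. [folklore] -/
@[simp]
theorem mem_normalDomain {p : E3 × (E4 →L[ℝ] E4 →L[ℝ] ℝ)} : p ∈ normalDomain ↔ normSq p < 0 :=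
  Iff.rfl

/-! ### Invertible bilinear forms -/

/-- `dim (E4 →L ℝ) = dim E4`. [folklore] -/
theorem finrank_dual_E4 : finrank ℝ (E4 →L[ℝ] ℝ) = finrank ℝ E4 := by
  rw [← (LinearMap.toContinuousLinearMap (𝕜 := ℝ) (E := E4) (F' := ℝ)).finrank_eq]
  exact Subspace.dual_finrank_eq

/-- **A nondegenerate bilinear form on `E4` is an invertible map `E4 → (E4 →L ℝ)`** (injective
between spaces of the same finite dimension). [folklore] -/
theorem isInvertible_of_nondegenerate (β : E4 →L[ℝ] E4 →L[ℝ] ℝ)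
    (hβ : ∀ v : E4, (∀ w : E4, β v w = 0) → v = 0) :
    (β : E4 →L[ℝ] (E4 →L[ℝ] ℝ)).IsInvertible := by
  have hinj : Function.Injective (β : E4 →ₗ[ℝ] (E4 →L[ℝ] ℝ)) := by
    refine (injective_iff_map_eq_zero _).2 fun v hv ↦ hβ v fun w ↦ ?_
    rw [ContinuousLinearMap.coe_coe] at hv
    rw [hv]; rfl
  refine ⟨(LinearMap.linearEquivOfInjective (β : E4 →ₗ[ℝ] (E4 →L[ℝ] ℝ)) hinj
    finrank_dual_E4.symm).toContinuousLinearEquiv, ?_⟩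
  ext v w
  rfl

/-- For invertible `β`, `β(β⁻¹ ω) = ω`: the raw normal solves `β(n, ·) = cylConormal y`.
[folklore] -/
theorem apply_rawNormal {β : E4 →L[ℝ] E4 →L[ℝ] ℝ} (hβ : (β : E4 →L[ℝ] (E4 →L[ℝ] ℝ)).IsInvertible)
    (y : E3) : β (rawNormal y β) = cylConormal y :=
  hβ.self_apply_inverse (cylConormal y)

/-- **The raw normal is `β`-normal to the cylinder**: `β(n, dψ_y v) = 0`. [folklore] -/
theorem apply_rawNormal_schwCylDeriv {β : E4 →L[ℝ] E4 →L[ℝ] ℝ}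
    (hβ : (β : E4 →L[ℝ] (E4 →L[ℝ] ℝ)).IsInvertible) (r₀ : ℝ) {y : E3} (hy : y ≠ 0) (v : E3) :
    β (rawNormal y β) (schwCylDeriv r₀ y v) = 0 := by
  rw [apply_rawNormal hβ, cylConormal_schwCylDeriv r₀ hy]

/-- The raw normal is nonzero for invertible `β` and `y ≠ 0`. [folklore] -/
theorem rawNormal_ne_zero {β : E4 →L[ℝ] E4 →L[ℝ] ℝ} (hβ : (β : E4 →L[ℝ] (E4 →L[ℝ] ℝ)).IsInvertible)
    {y : E3} (hy : y ≠ 0) : rawNormal y β ≠ 0 := by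
  intro h
  have h1 : β (rawNormal y β) (E4.spaceEmbed y) = ‖y‖ ^ 2 := by
    rw [apply_rawNormal hβ, cylConormal_spaceEmbed_self]
  rw [h, map_zero, zero_apply] at h1
  exact hy (by rwa [eq_comm, sq_eq_zero_iff, norm_eq_zero] at h1)

/-- `⟪y, x⃗(n)⟫ = β(n, n)`: the radial component of the raw normal is its `β`-square (pair
`β(n, ·) = cylConormal y` with `n`). Valid for every `β` (both sides vanish in the junk case).
[folklore] -/
theorem cylConormal_rawNormal (p : E3 × (E4 →L[ℝ] E4 →L[ℝ] ℝ)) :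
    cylConormal p.1 (rawNormal p.1 p.2) = normSq p := by
  by_cases hβ : (p.2 : E4 →L[ℝ] (E4 →L[ℝ] ℝ)).IsInvertible
  · rw [normSq, apply_rawNormal hβ]
  · have h0 : rawNormal p.1 p.2 = 0 := by
      rw [rawNormal, ContinuousLinearMap.inverse_of_not_isInvertible hβ]; rfl
    rw [normSq, h0, map_zero, map_zero]

/-! ### On the normal domain -/

/-- On `normalDomain` the scale `(−β(n, n))^{-1/2}` is positive. [folklore] -/
theorem scale_pos {p : E3 × (E4 →L[ℝ] E4 →L[ℝ] ℝ)} (hp : p ∈ normalDomain) :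
    0 < (Real.sqrt (-normSq p))⁻¹ :=
  inv_pos.2 (Real.sqrt_pos.2 (by rw [mem_normalDomain] at hp; linarith))

/-- **The unit normal points to decreasing area radius, for EVERY form `β`**:
`⟪y, x⃗(unitNormalOf (y, β))⟫ = (−β(n,n))^{-1/2} β(n, n) < 0` on `normalDomain`. This is why the sign
of the unit normal is pinned metric-independently by "`x⃗`-component inward". [folklore] -/
theorem inner_spatial_unitNormalOf_neg {p : E3 × (E4 →L[ℝ] E4 →L[ℝ] ℝ)} (hp : p ∈ normalDomain) :
    ⟪p.1, E4.spatial (unitNormalOf p)⟫ < 0 := by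
  have h := cylConormal_rawNormal p
  rw [cylConormal_apply] at h
  rw [unitNormalOf, map_smul, inner_smul_right, h]
  exact mul_neg_of_pos_of_neg (scale_pos hp) hp

/-- On `normalDomain`, for symmetric-or-not `β`: the unit normal is `β`-normal to the cylinder,
`β(ν, dψ_y v) = 0` (`β` is invertible there). [folklore] -/
theorem apply_unitNormalOf_schwCylDeriv {p : E3 × (E4 →L[ℝ] E4 →L[ℝ] ℝ)}
    (hβ : (p.2 : E4 →L[ℝ] (E4 →L[ℝ] ℝ)).IsInvertible) (r₀ : ℝ) (hy : p.1 ≠ 0) (v : E3) :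
    p.2 (unitNormalOf p) (schwCylDeriv r₀ p.1 v) = 0 := by
  rw [unitNormalOf, map_smul, smul_apply, apply_rawNormal_schwCylDeriv hβ r₀ hy, smul_zero]

/-- **On `normalDomain` the unit normal has `β`-square `−1`.** [folklore] -/
theorem apply_unitNormalOf_self {p : E3 × (E4 →L[ℝ] E4 →L[ℝ] ℝ)} (hp : p ∈ normalDomain) :
    p.2 (unitNormalOf p) (unitNormalOf p) = -1 := by
  have hq : normSq p < 0 := hp
  have hs : Real.sqrt (-normSq p) ^ 2 = -normSq p := Real.sq_sqrt (by linarith)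
  have hs0 : Real.sqrt (-normSq p) ≠ 0 := (Real.sqrt_pos.2 (by linarith)).ne'
  rw [unitNormalOf, map_smul, map_smul, smul_apply, smul_eq_mul, smul_eq_mul]
  change (Real.sqrt (-normSq p))⁻¹ * ((Real.sqrt (-normSq p))⁻¹ * normSq p) = -1
  field_simp
  linarith

/-! ### Openness of the domain and smoothness of the unit normal -/

/-- The set of pairs `(y, β)` with `β` invertible is open. [folklore] -/
theorem isOpen_setOf_invertible :
    IsOpen {p : E3 × (E4 →L[ℝ] E4 →L[ℝ] ℝ) | (p.2 : E4 →L[ℝ] (E4 →L[ℝ] ℝ)).IsInvertible} :=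
  (ContinuousLinearEquiv.isOpen (𝕜 := ℝ) (E := E4) (F := E4 →L[ℝ] ℝ)).preimage continuous_snd

/-- `(y, β) ↦ rawNormal y β` is smooth on the invertible pairs (`contDiffAt_map_inverse`).
[folklore] -/
theorem contDiffOn_rawNormal {n : ℕ∞ω} :
    ContDiffOn ℝ n (fun p : E3 × (E4 →L[ℝ] E4 →L[ℝ] ℝ) ↦ rawNormal p.1 p.2)
      {p | (p.2 : E4 →L[ℝ] (E4 →L[ℝ] ℝ)).IsInvertible} := by
  rintro p ⟨e, he⟩
  have hinv : ContDiffAt ℝ n (fun p : E3 × (E4 →L[ℝ] E4 →L[ℝ] ℝ) ↦ ContinuousLinearMap.inverse p.2) p := by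
    have h := contDiffAt_map_inverse (𝕜 := ℝ) (n := n) e
    rw [he] at h
    exact h.comp p contDiffAt_snd
  have hω : ContDiffAt ℝ n (fun p : E3 × (E4 →L[ℝ] E4 →L[ℝ] ℝ) ↦ cylConormal p.1) p :=
    contDiff_cylConormal.contDiffAt.comp p contDiffAt_fst
  exact (hinv.clm_apply hω).contDiffWithinAt

/-- `normSq` is smooth on the invertible pairs. [folklore] -/
theorem contDiffOn_normSq {n : ℕ∞ω} :
    ContDiffOn ℝ n normSq
      {p : E3 × (E4 →L[ℝ] E4 →L[ℝ] ℝ) | (p.2 : E4 →L[ℝ] (E4 →L[ℝ] ℝ)).IsInvertible} :=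
  (contDiffOn_snd.clm_apply contDiffOn_rawNormal).clm_apply contDiffOn_rawNormal

/-- `normalDomain` lies in the invertible pairs. [folklore] -/
theorem normalDomain_subset_invertible :
    normalDomain ⊆ {p : E3 × (E4 →L[ℝ] E4 →L[ℝ] ℝ) | (p.2 : E4 →L[ℝ] (E4 →L[ℝ] ℝ)).IsInvertible} := by
  intro p hp
  by_contra hβ
  have h0 : rawNormal p.1 p.2 = 0 := by
    rw [rawNormal, ContinuousLinearMap.inverse_of_not_isInvertible hβ]; rfl
  have : normSq p = 0 := by rw [normSq, h0, map_zero]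
  rw [mem_normalDomain, this] at hp
  exact lt_irrefl _ hp

/-- **`normalDomain` is open.** [folklore] -/
theorem isOpen_normalDomain : IsOpen normalDomain := by
  have h : normalDomain = {p : E3 × (E4 →L[ℝ] E4 →L[ℝ] ℝ) |
      (p.2 : E4 →L[ℝ] (E4 →L[ℝ] ℝ)).IsInvertible} ∩ normSq ⁻¹' Iio 0 := by
    ext p
    exact ⟨fun hp ↦ ⟨normalDomain_subset_invertible hp, hp⟩, fun hp ↦ hp.2⟩
  rw [h]
  exact (contDiffOn_normSq (n := 0)).continuousOn.isOpen_inter_preimage isOpen_setOf_invertible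
    isOpen_Iio

/-- **The unit normal is a smooth function of `(y, β)` on `normalDomain`** (inversion, evaluation,
`√` off `0`). [folklore] -/
theorem contDiffOn_unitNormalOf {n : ℕ∞ω} : ContDiffOn ℝ n unitNormalOf normalDomain := by
  intro p hp
  have hpi := normalDomain_subset_invertible hp
  have hs : normalDomain ∈ 𝓝 p := isOpen_normalDomain.mem_nhds hp
  have hraw : ContDiffAt ℝ n (fun p : E3 × (E4 →L[ℝ] E4 →L[ℝ] ℝ) ↦ rawNormal p.1 p.2) p :=
    (contDiffOn_rawNormal p hpi).contDiffAt (isOpen_setOf_invertible.mem_nhds hpi)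
  have hq : ContDiffAt ℝ n normSq p :=
    (contDiffOn_normSq p hpi).contDiffAt (isOpen_setOf_invertible.mem_nhds hpi)
  have hq0 : normSq p < 0 := hp
  have hsqrt : ContDiffAt ℝ n (fun p ↦ Real.sqrt (-normSq p)) p :=
    hq.neg.sqrt (by linarith)
  have hinv : ContDiffAt ℝ n (fun p ↦ (Real.sqrt (-normSq p))⁻¹) p :=
    hsqrt.inv (Real.sqrt_pos.2 (by linarith)).ne'
  exact (hinv.smul hraw).contDiffWithinAt

/-! ### Identification of unit normals (pointwise) -/

/-- **Every oriented unit normal of the cylinder is `unitNormalOf` (pointwise).** Let `g` be a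
Lorentzian metric on a chart domain `V ⊆ E4`, `x ∈ V`, `y ≠ 0`, and suppose the model differential
`dψ_y = schwCylDeriv r₀ y` is spacelike for `g_x`. If `n` is `g_x`-normal to `dψ_y(E3)` with
`g_x(n, n) = −1` and its spatial part points to decreasing area radius (`⟪y, x⃗(n)⟫ < 0`), then
`(y, g_x) ∈ normalDomain` and `n = unitNormalOf (y, g_x)`. Proof: the raw normal
`g_x⁻¹(conormal)` is `g_x`-normal to `dψ_y(E3)` and nonzero, so it is a nonzero multiple of `n`
(`smul_of_normal_of_unit`), hence timelike; `unitNormalOf` is then a unit normal of sign `−1`, equal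
to `± n` (`eq_or_eq_neg_of_normal_of_unit`), and the sign is `+` because both have inward spatial
part (`inner_spatial_unitNormalOf_neg`). O'Neill 1983, Ch. 4, pp. 106–107; Ch. 5, Lemma 5.26.
[cite: ONeill1983, Ch. 5, Lemma 5.26] -/
theorem eq_unitNormalOf {V : Opens E4} (g : LorentzianMetric 𝓘(ℝ, E4) ∞ V) (x : V) {r₀ : ℝ}
    {y : E3} (hy : y ≠ 0)
    (hpos : ∀ v : E3, v ≠ 0 → 0 < g.val x (schwCylDeriv r₀ y v) (schwCylDeriv r₀ y v))
    {n : E4} (hn : ∀ v : E3, g.val x n (schwCylDeriv r₀ y v) = 0) (hu : g.val x n n = -1)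
    (hor : ⟪y, E4.spatial n⟫ < 0) :
    (y, (show E4 →L[ℝ] E4 →L[ℝ] ℝ from g.val x)) ∈ normalDomain ∧
      n = unitNormalOf (y, (show E4 →L[ℝ] E4 →L[ℝ] ℝ from g.val x)) := by
  set β : E4 →L[ℝ] E4 →L[ℝ] ℝ := show E4 →L[ℝ] E4 →L[ℝ] ℝ from g.val x with hβ_def
  have hval : g.val x = β := rfl
  have hnd : (β : E4 →L[ℝ] (E4 →L[ℝ] ℝ)).IsInvertible :=
    isInvertible_of_nondegenerate β fun v hv ↦ g.nondegenerate x v hv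
  -- the raw normal is normal and nonzero, hence timelike
  have h₂ : ∀ v : E3, g.val x (rawNormal y β) (schwCylDeriv r₀ y v) = 0 :=
    fun v ↦ apply_rawNormal_schwCylDeriv hnd r₀ hy v
  have hq : normSq (y, β) < 0 :=
    g.val_self_neg_of_normal_of_unit finrank_E4_eq (schwCylDeriv r₀ y) hpos hn h₂ hu
      (rawNormal_ne_zero hnd hy)
  have hmem : (y, β) ∈ normalDomain := hq
  refine ⟨hmem, ?_⟩
  -- `unitNormalOf` is a unit normal of sign `−1`
  have h₃ : ∀ v : E3, g.val x (unitNormalOf (y, β)) (schwCylDeriv r₀ y v) = 0 :=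
    fun v ↦ apply_unitNormalOf_schwCylDeriv (p := (y, β)) hnd r₀ hy v
  have hu₃ : g.val x (unitNormalOf (y, β)) (unitNormalOf (y, β)) = -1 := apply_unitNormalOf_self hmem
  rcases g.eq_or_eq_neg_of_normal_of_unit finrank_E4_eq (schwCylDeriv r₀ y) hpos hn h₃ hu hu₃
    with h | h
  · exact h.symm
  · exfalso
    have hneg := inner_spatial_unitNormalOf_neg hmem
    have heq : E4.spatial (unitNormalOf (y, β)) = -E4.spatial n := by
      rw [h]; exact map_neg E4.spatial _
    change ⟪y, E4.spatial (unitNormalOf (y, β))⟫ < 0 at hneg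
    rw [heq, inner_neg_right] at hneg
    linarith

/-- The spatial part of the model normal points inward: `⟪y, x⃗(ν_M)⟫ < 0` for `0 < r₀ < 2M`,
`y ≠ 0` (`x⃗(ν_M) = (2M/r₀ − 1)^{-1/2}(1 − 2M/r₀) y/‖y‖`). [cite: LiMei2020, (4.1)] -/
theorem inner_spatial_schwCylNormalRep_neg {M r₀ : ℝ} (hr₀ : 0 < r₀) (h2M : r₀ < 2 * M) {y : E3}
    (hy : y ≠ 0) : ⟪y, E4.spatial (schwCylNormalRep M r₀ y)⟫ < 0 := by
  rw [spatial_schwCylNormalRep, inner_smul_right, real_inner_self_eq_norm_sq]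
  have hn : 0 < ‖y‖ := norm_pos_iff.2 hy
  have hlt : 1 < 2 * M / r₀ := by rw [lt_div_iff₀ hr₀]; linarith
  have h1 : 1 - 2 * M / r₀ < 0 := by linarith
  have h2 : 0 < (Real.sqrt (2 * M / r₀ - 1))⁻¹ := inv_pos.2 (Real.sqrt_pos.2 (by linarith))
  have h3 : (Real.sqrt (2 * M / r₀ - 1))⁻¹ * ((1 - 2 * M / r₀) * ‖y‖⁻¹) < 0 :=
    mul_neg_of_pos_of_neg h2 (mul_neg_of_neg_of_pos h1 (inv_pos.2 hn))
  exact mul_neg_of_neg_of_pos h3 (by positivity)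

/-- **The model normal is `unitNormalOf`**: for `0 < r₀ < 2M` and every `y ≠ 0`, the
Schwarzschild-cylinder unit normal `schwCylNormalRep M r₀ y` of `InteriorKerrGluingProofs.lean`
equals `unitNormalOf (y, g_M(ψ y))`, and `(y, g_M(ψ y)) ∈ normalDomain` (read at the point
`ψ y ∈ Kerr.region 0 0` of the Kerr–Schild chart). Li–Mei arXiv:2005.01249, (4.1).
[cite: LiMei2020, (4.1)] -/
theorem schwCylNormalRep_eq_unitNormalOf [Kerr.Facts] {M r₀ : ℝ} (hr₀ : 0 < r₀) (h2M : r₀ < 2 * M)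
    {y : E3} (hy : y ≠ 0) :
    (y, Kerr.bilin M 0 (schwCylMap r₀ 0 y)) ∈ normalDomain ∧
      schwCylNormalRep M r₀ y = unitNormalOf (y, Kerr.bilin M 0 (schwCylMap r₀ 0 y)) := by
  have hmem : schwCylMap r₀ 0 y ∈ Kerr.region 0 0 := by
    rw [Kerr.mem_region, radius_schwCylMap hr₀ 0 hy, max_self]
    exact hr₀
  have hpos : ∀ v : E3, v ≠ 0 → 0 < (Kerr.smoothMetric M 0 0).val ⟨_, hmem⟩ (schwCylDeriv r₀ y v)
      (schwCylDeriv r₀ y v) := fun v hv ↦ by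
    rw [Kerr.smoothMetric_val]
    change 0 < Kerr.bilin M 0 (schwCylMap r₀ 0 y) (schwCylDeriv r₀ y v) (schwCylDeriv r₀ y v)
    rw [bilin_schwCylDeriv M hr₀ 0 hy]
    exact gbarRep_pos hr₀ h2M hy hv
  have hn : ∀ v : E3, (Kerr.smoothMetric M 0 0).val ⟨_, hmem⟩ (schwCylNormalRep M r₀ y)
      (schwCylDeriv r₀ y v) = 0 := fun v ↦ by
    rw [Kerr.smoothMetric_val]
    exact bilin_schwCylNormalRep_schwCylDeriv M hr₀ 0 hy v
  have hu : (Kerr.smoothMetric M 0 0).val ⟨_, hmem⟩ (schwCylNormalRep M r₀ y)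
      (schwCylNormalRep M r₀ y) = -1 := by
    rw [Kerr.smoothMetric_val]
    exact bilin_schwCylNormalRep_self M hr₀ h2M 0 hy
  exact eq_unitNormalOf (Kerr.smoothMetric M 0 0) ⟨_, hmem⟩ hy hpos hn hu
    (inner_spatial_schwCylNormalRep_neg hr₀ h2M hy)

end LiMei

end Literature.Geometry.Lorentzian

end
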